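import Summits.QuantumAdvantage.QuantumAdvantage.Theses.SosSandwich
import Summits.QuantumAdvantage.QuantumAdvantage.Theorems.SosSandwichOneQueryFrameAA

/-!
# Crux `PseudoBoundedAA` (stmt-QuantumAdvantage-15237, route SosSandwich), line `birth` — stub `stub_oneQuery`

The ORDER-ONE base class of the line (`K_1`: `p` and `1 - p` sums of squares of affine functions on the
cube ⟹ `4·Var[p]² ≤ 9·maxᵢ Infᵢ[p]`) is the route's support item `OneQueryFrameAA`
(stmt-QuantumAdvantage-15240), which is PROVED in the tree
(`Theorems/SosSandwichOneQueryFrameAA.lean`, `OneQueryFrameAA_proof`: flat Gram matrix `0 ≼ M ≼ D`,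
two test vectors, Bessel). The registered stub `stub_oneQuery : OneQueryFrameAA` of
`Cruxes/PseudoBoundedAA/Lines/birth.lean` is that theorem BY NAME.
-/

-- D-0017: single-conjunct summit ⇒ the duplicate `QuantumAdvantage.QuantumAdvantage` is mandated.
set_option linter.dupNamespace false

namespace Summit.QuantumAdvantage.QuantumAdvantage.Cruxes.PseudoBoundedAA.Birth

open Summit.QuantumAdvantage.QuantumAdvantage.Theses.SosSandwich (OneQueryFrameAA)

/-- **Stub `stub_oneQuery` of line `birth`** (registered signature `OneQueryFrameAA`): if `p` and `1 - p`
are sums of squares of polynomials of total degree `≤ 1` on the cube `{0,1}^N` and `Var[p] > 0`, then some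
variable `i` has `4·Var[p]² ≤ 9·Inf_i[p]` — the route's support item stmt-QuantumAdvantage-15240, closed in
the tree by `Theorems.SosSandwich.OneQueryFrameAA_proof`. [cite: ODonnell2014, §1.4 and §2.2]
[cite: KaniewskiLeeDewolf2015, Thm. 12] -/
theorem stub_oneQuery : OneQueryFrameAA :=
  Summit.QuantumAdvantage.QuantumAdvantage.Theorems.SosSandwich.OneQueryFrameAA_proof

end Summit.QuantumAdvantage.QuantumAdvantage.Cruxes.PseudoBoundedAA.Birth
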